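import Summits.Ventures.DiscreteObjects.PP12.OrderElevenReduction
import Summits.Ventures.DiscreteObjects.PP12.OrderElevenHomologyLift
import Summits.Ventures.DiscreteObjects.PP12.OrderElevenTriangleLiftPlane
import Summits.Ventures.DiscreteObjects.PP12.OrderThirteenLift
import Summits.Ventures.DiscreteObjects.PP12.TwoThreeGroupIffCells

/-!
# PP(12), prime cells p = 11, 13: the typed array statements are EXACT (kernel; bookkeeping)
Framing: lottery ticket; floor = certified bounds/negative ranges.

Cell pub-namedobj (venture DiscreteObjects), target (M), designs gen 16. Collecting both directions:
* `OrderElevenReduction.noOrderEleven_of_noCollineationOfOrderEleven` (plane ⇒ arrays) with the converses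
  `OrderElevenHomologyLift.noHomologyArray12_of_noOrderEleven` (Case A array ⇒ plane) and
  `OrderElevenTriangleLiftPlane.noTriangleData12_of_noOrderEleven` (Case B data ⇒ plane):
  **`noCollineationOfOrderEleven_iff : NoCollineationOfOrderEleven ↔ NoOrderElevenOrder12`**;
* with `OrderThirteenLift.noLiftData13_iff` and `TwoThreeGroupIffCells.twoThreeGroup_iff_cells`:
  **`twoThreeGroup_iff_arrays : CollineationGroupIsTwoThreeGroup ↔ NoOrderFiveOrder12 ∧ NoCollineationOfOrderEleven ∧ NoLiftData13`** —
  Janko–van Trung's named fact (Literature) is, in the kernel, equivalent to the plane-level order-5 cell together with the two FINITE array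
  statements of `OrderElevenCollineation` / `OrderThirteenCollineation` (decided EMPTY outside the kernel, designs E1 + farm twins; in print JvT 1981/82).
Nothing here asserts any of these statements. No `sorry`, no new axioms.
-/

namespace Summit.Ventures.DiscreteObjects.PP12

/-- **The census statement of the order-11 cell is exact.** -/
theorem noCollineationOfOrderEleven_iff : NoCollineationOfOrderEleven ↔ NoOrderElevenOrder12 :=
  ⟨noOrderEleven_of_noCollineationOfOrderEleven, fun h => ⟨noHomologyArray12_of_noOrderEleven h, noTriangleData12_of_noOrderEleven h⟩⟩

open Literature.Combinatorics.Designs in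
/-- **Janko–van Trung's `{2,3}`-group theorem ⇔ the order-5 cell and the two finite array statements.** -/
theorem twoThreeGroup_iff_arrays :
    CollineationGroupIsTwoThreeGroup ↔ NoOrderFiveOrder12 ∧ NoCollineationOfOrderEleven ∧ NoLiftData13 := by
  rw [twoThreeGroup_iff_cells, noCollineationOfOrderEleven_iff, noLiftData13_iff]

end Summit.Ventures.DiscreteObjects.PP12
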